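import Summits.AtomisticToContinuum.Crystallization.Theorems.FrustratedLawDichotomyStrainedPatchHomSlabLeaf
import Summits.AtomisticToContinuum.Crystallization.Theorems.FrustratedLawDichotomyStrainedPatchHomForceJacFar
import Summits.AtomisticToContinuum.Crystallization.Theorems.FrustratedLawDichotomyStrainedPatchHomCurvLeafHCC
import Summits.AtomisticToContinuum.Crystallization.Theorems.FrustratedLawDichotomyStrainedPatchHomCurvLJSmoke
import Summits.AtomisticToContinuum.Crystallization.Theorems.FrustratedLawDichotomyStrainedPatchHomSlopeLJ

/-!
# `entryLeafOKHT` KIT: label bookkeeping over `[−11,11]³` and the certificate payload / PSD confinement certificate of the analytic-slab ξ-box leaf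
# (27623 `(H) HomFloor (1/625)`, hcp half; critic rows 1108 (3) (iii) / 1110 (2))

decomp-a2c hand-1 g29 (crux `AperiodicFrustratedLawGap`, stmt-AtomisticToContinuum-27623).  Kernel definitions + soundness lemmas used by
`…HomEntryLeafHT.entryLeafOKHT` / `entryLeafOKHT_sound`:

* §1 label bookkeeping by PREDICATES over `…HomForceJacFar.boxLabels11` (no `List.contains`): `htIn` (certainly inside the `7`-ball: `fjQ.hi ≤ 49·SC`),
  `htNear`/`htCen`/`htNai` (near labels `ρ² < 22.09`, centred/naive split by `…HomCurvLJSmoke.isCenLJ`), `htFar1`/`htFar2` (windows `[22.09, 36)`, `[36, ∞)`),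
  `htB` (concatenation, `htB_nodup`, `mem_htB_of_htIn`), `htR`/`htROK` (straddlers, all `≥ 6`), `htSc`/`htSn` (slope split on the reference box `refW`);
  `mem_fjQ`, `norm_le_seven_of_htIn`, `lo_le_of_norm_le_seven`, `six_le_norm_of_lo`;
* §2 `HTCert` (payload: `D, lam₁, lam₂, lam₃, Gs, γS, rS`), the scaled slab constant `htT` (`8892/7⁷·SC + Gs + |R|·⌈SC/6⁷⌉`), the integer certificate
  matrix `htN = 2γr(λ_T·1 + D) − t·SC²·1 − tγ²·e_k e_kᵀ` with `htConf` (`hertzTest` on the point matrix) and ★ `htConf_sound` (⟹ the hypothesis of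
  `…HomSlabConfine.abs_apply_le_of_qcert`), the row deviations `htκ` (`rowDev_le`), `htρ` (`sqrt_le_htρ`), the confined widths `htW`, `htCertOK`.

Kernel definitions + soundness; 0 sorry; standard axioms; no instances / notation / `#eval`.  `--supports stmt-AtomisticToContinuum-27623`.
-/

noncomputable section

namespace Summit.AtomisticToContinuum.Crystallization.Theorems.FrustratedLawDichotomyStrainedPatchHomEntryLeafHT

open scoped BigOperators RealInnerProductSpace
open Literature.Analysis.ValidatedNumerics.Numerics
open Summit.AtomisticToContinuum.Crystallization.Theorems.ChargedEnergyGapNegative (E3)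
open Summit.AtomisticToContinuum.Crystallization.Theorems.FrustratedLawDichotomyStrainedPatchHomSplit (ExRec latPt hexFrame hcpShift)
open Summit.AtomisticToContinuum.Crystallization.Theorems.FrustratedLawDichotomyStrainedPatchHomEntryGram (entryFI mem_entryFI)
open Summit.AtomisticToContinuum.Crystallization.Theorems.FrustratedLawDichotomyStrainedPatchHomEntryGramHcp (dot3 shufFI mem_dot3 mem_shufFI)
open Summit.AtomisticToContinuum.Crystallization.Theorems.FrustratedLawDichotomyStrainedPatchHomForceKit (vecB mem_vecB)
open Summit.AtomisticToContinuum.Crystallization.Theorems.FrustratedLawDichotomyStrainedPatchHomHertzKit (hertzTest quadForm_ge_of_hertzTest)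
open Summit.AtomisticToContinuum.Crystallization.Theorems.FrustratedLawDichotomyStrainedPatchHomCurvLeaf
  (nodup_filter_append toFinset_filter_append)
open Summit.AtomisticToContinuum.Crystallization.Theorems.FrustratedLawDichotomyStrainedPatchHomCurvLeafL2 (refW)
open Summit.AtomisticToContinuum.Crystallization.Theorems.FrustratedLawDichotomyStrainedPatchHomCurvLJ (isCenLJ curvCheckLJM)
open Summit.AtomisticToContinuum.Crystallization.Theorems.FrustratedLawDichotomyStrainedPatchHomForceJacN
  (fjQ fjVec fjE fjX forceJacCheckN boxLabels11 boxLabels11_toFinset boxLabels11_nodup)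
open Summit.AtomisticToContinuum.Crystallization.Theorems.FrustratedLawDichotomyStrainedPatchHomSlopeLJ (slopeLJLabelOK slopeCheckLJ forceLJ_ref_bound_of_check)

/-! ## §1. Label bookkeeping over `[−11,11]³` -/

/-- Certainly inside the `7`-ball on the box: `fjQ.hi ≤ 49·SC`. -/
def htIn (c w : (Fin 3 × Fin 3) ⊕ Fin 3 → ℤ) (b : Fin 3 → ℤ) : Bool := decide ((fjQ c w b).hi ≤ 49 * (SC : ℤ))

/-- The near threshold `(22.09)↑` (scaled): below it the labels go through the centred/naive curvature kit. -/
def htA1 : ℤ := (FI.ofFrac 2209 100).hi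

/-- Near labels: certainly inside, squared-radius lower end `< 22.09`. -/
def htNear (c w : (Fin 3 × Fin 3) ⊕ Fin 3 → ℤ) : List (Fin 3 → ℤ) :=
  boxLabels11.filter fun b => htIn c w b && decide ((fjQ c w b).lo < htA1)

/-- Centred near labels. -/
def htCen (c w : (Fin 3 × Fin 3) ⊕ Fin 3 → ℤ) : List (Fin 3 → ℤ) := (htNear c w).filter fun b => isCenLJ c w b

/-- Naive near labels. -/
def htNai (c w : (Fin 3 × Fin 3) ⊕ Fin 3 → ℤ) : List (Fin 3 → ℤ) := (htNear c w).filter fun b => !isCenLJ c w b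

/-- Far chunk 1: certainly inside, squared-radius lower end in `[22.09, 36)`. -/
def htFar1 (c w : (Fin 3 × Fin 3) ⊕ Fin 3 → ℤ) : List (Fin 3 → ℤ) :=
  boxLabels11.filter fun b => htIn c w b && !decide ((fjQ c w b).lo < htA1) && decide ((fjQ c w b).lo < 36 * (SC : ℤ))

/-- Far chunk 2: certainly inside, squared-radius lower end `≥ 36`. -/
def htFar2 (c w : (Fin 3 × Fin 3) ⊕ Fin 3 → ℤ) : List (Fin 3 → ℤ) :=
  boxLabels11.filter fun b => htIn c w b && !decide ((fjQ c w b).lo < htA1) && !decide ((fjQ c w b).lo < 36 * (SC : ℤ))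

/-- All certainly-inside labels, in certificate order `((centred ++ naive) ++ far₁) ++ far₂`. -/
def htB (c w : (Fin 3 × Fin 3) ⊕ Fin 3 → ℤ) : List (Fin 3 → ℤ) := ((htCen c w ++ htNai c w) ++ htFar1 c w) ++ htFar2 c w

/-- Straddlers: not certainly inside, but possibly inside (`fjQ.lo ≤ 49·SC`). -/
def htR (c w : (Fin 3 × Fin 3) ⊕ Fin 3 → ℤ) : List (Fin 3 → ℤ) :=
  boxLabels11.filter fun b => !htIn c w b && decide ((fjQ c w b).lo ≤ 49 * (SC : ℤ))

/-- Every straddler is certainly `≥ 6` from the centre. -/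
def htROK (c w : (Fin 3 × Fin 3) ⊕ Fin 3 → ℤ) : Bool := (htR c w).all fun b => decide (36 * (SC : ℤ) ≤ (fjQ c w b).lo)

/-- Slope split of `htB` on the reference box: centred labels. -/
def htSc (c w : (Fin 3 × Fin 3) ⊕ Fin 3 → ℤ) : List (Fin 3 → ℤ) := (htB c w).filter fun b => slopeLJLabelOK c (refW w) b

/-- Slope split of `htB` on the reference box: naive labels. -/
def htSn (c w : (Fin 3 × Fin 3) ⊕ Fin 3 → ℤ) : List (Fin 3 → ℤ) := (htB c w).filter fun b => !slopeLJLabelOK c (refW w) b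

/-- `fjQ` encloses `‖X_b‖²` at every point of the box. [folklore] -/
theorem mem_fjQ {c w : (Fin 3 × Fin 3) ⊕ Fin 3 → ℤ} (U : E3 →L[ℝ] E3)
    (hbox : ∀ ab : Fin 3 × Fin 3, |(U (EuclideanSpace.single ab.2 (1 : ℝ))) ab.1 - (c (Sum.inl ab) : ℝ) / SC| ≤ (w (Sum.inl ab) : ℝ) / SC)
    (ξ : E3) (hξ : ∀ i : Fin 3, |ξ i - (c (Sum.inr i) : ℝ) / SC| ≤ (w (Sum.inr i) : ℝ) / SC) (b : Fin 3 → ℤ) :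
    FI.mem (‖latPt U hexFrame b + U (hcpShift + ξ)‖ ^ 2) (fjQ c w b) := by
  have hE : ∀ ab : Fin 3 × Fin 3, FI.mem ((U (EuclideanSpace.single ab.2 (1 : ℝ))) ab.1) (fjE c w ab) := fun ab => mem_entryFI (hbox ab)
  have hX : ∀ i, FI.mem (ξ i) (fjX c w i) := fun i => mem_shufFI (hξ i)
  have hv : ∀ a, FI.mem ((latPt U hexFrame b + U (hcpShift + ξ)) a) (fjVec c w b a) := fun a => mem_vecB U ξ hE hX b a
  rw [← real_inner_self_eq_norm_sq]
  exact mem_dot3 hv hv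

/-- A certainly-inside label is inside: `htIn ⟹ ‖X_b‖ ≤ 7`. [folklore] -/
theorem norm_le_seven_of_htIn {c w : (Fin 3 × Fin 3) ⊕ Fin 3 → ℤ} (U : E3 →L[ℝ] E3)
    (hbox : ∀ ab : Fin 3 × Fin 3, |(U (EuclideanSpace.single ab.2 (1 : ℝ))) ab.1 - (c (Sum.inl ab) : ℝ) / SC| ≤ (w (Sum.inl ab) : ℝ) / SC)
    (ξ : E3) (hξ : ∀ i : Fin 3, |ξ i - (c (Sum.inr i) : ℝ) / SC| ≤ (w (Sum.inr i) : ℝ) / SC) {b : Fin 3 → ℤ} (h : htIn c w b = true) :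
    ‖latPt U hexFrame b + U (hcpShift + ξ)‖ ≤ 7 := by
  have hS : (0 : ℝ) < SC := by norm_num [SC]
  simp only [htIn, decide_eq_true_eq] at h
  have hm := (mem_fjQ U hbox ξ hξ b).2
  have h' : ((fjQ c w b).hi : ℝ) ≤ 49 * SC := by exact_mod_cast h
  have hsq : ‖latPt U hexFrame b + U (hcpShift + ξ)‖ ^ 2 ≤ 7 ^ 2 := by nlinarith
  exact abs_le_of_sq_le_sq' hsq (by norm_num) |>.2

/-- An inside label is possibly inside: `‖X_b‖ ≤ 7 ⟹ fjQ.lo ≤ 49·SC`. [folklore] -/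
theorem lo_le_of_norm_le_seven {c w : (Fin 3 × Fin 3) ⊕ Fin 3 → ℤ} (U : E3 →L[ℝ] E3)
    (hbox : ∀ ab : Fin 3 × Fin 3, |(U (EuclideanSpace.single ab.2 (1 : ℝ))) ab.1 - (c (Sum.inl ab) : ℝ) / SC| ≤ (w (Sum.inl ab) : ℝ) / SC)
    (ξ : E3) (hξ : ∀ i : Fin 3, |ξ i - (c (Sum.inr i) : ℝ) / SC| ≤ (w (Sum.inr i) : ℝ) / SC) {b : Fin 3 → ℤ}
    (h : ‖latPt U hexFrame b + U (hcpShift + ξ)‖ ≤ 7) : (fjQ c w b).lo ≤ 49 * (SC : ℤ) := by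
  have hS : (0 : ℝ) < SC := by norm_num [SC]
  have hm := (mem_fjQ U hbox ξ hξ b).1
  have hn := norm_nonneg (latPt U hexFrame b + U (hcpShift + ξ))
  have hsq : ‖latPt U hexFrame b + U (hcpShift + ξ)‖ ^ 2 ≤ 49 := by nlinarith
  have : ((fjQ c w b).lo : ℝ) ≤ 49 * SC := by nlinarith
  exact_mod_cast this

/-- `36·SC ≤ fjQ.lo ⟹ 6 ≤ ‖X_b‖`. [folklore] -/
theorem six_le_norm_of_lo {c w : (Fin 3 × Fin 3) ⊕ Fin 3 → ℤ} (U : E3 →L[ℝ] E3)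
    (hbox : ∀ ab : Fin 3 × Fin 3, |(U (EuclideanSpace.single ab.2 (1 : ℝ))) ab.1 - (c (Sum.inl ab) : ℝ) / SC| ≤ (w (Sum.inl ab) : ℝ) / SC)
    (ξ : E3) (hξ : ∀ i : Fin 3, |ξ i - (c (Sum.inr i) : ℝ) / SC| ≤ (w (Sum.inr i) : ℝ) / SC) {b : Fin 3 → ℤ}
    (h : 36 * (SC : ℤ) ≤ (fjQ c w b).lo) : 6 ≤ ‖latPt U hexFrame b + U (hcpShift + ξ)‖ := by
  have hS : (0 : ℝ) < SC := by norm_num [SC]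
  have hm := (mem_fjQ U hbox ξ hξ b).1
  have h' : 36 * (SC : ℝ) ≤ ((fjQ c w b).lo : ℝ) := by exact_mod_cast h
  have hsq : (6 : ℝ) ^ 2 ≤ ‖latPt U hexFrame b + U (hcpShift + ξ)‖ ^ 2 := by nlinarith
  nlinarith [norm_nonneg (latPt U hexFrame b + U (hcpShift + ξ)), abs_le_of_sq_le_sq' hsq (norm_nonneg _)]

/-- Every certainly-inside label of `[−11,11]³` lies in `htB`. [formal bookkeeping] -/
theorem mem_htB_of_htIn {c w : (Fin 3 × Fin 3) ⊕ Fin 3 → ℤ} {b : Fin 3 → ℤ} (hb : b ∈ boxLabels11) (h : htIn c w b = true) : b ∈ htB c w := by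
  simp only [htB, List.mem_append, htCen, htNai, htNear, htFar1, htFar2, List.mem_filter, hb, h, Bool.true_and, true_and]
  by_cases h1 : decide ((fjQ c w b).lo < htA1) = true
  · by_cases hc : isCenLJ c w b = true
    · exact Or.inl (Or.inl (Or.inl ⟨h1, hc⟩))
    · exact Or.inl (Or.inl (Or.inr ⟨h1, by simp [hc]⟩))
  · by_cases h2 : decide ((fjQ c w b).lo < 36 * (SC : ℤ)) = true
    · exact Or.inl (Or.inr (by simp [h1, h2]))
    · exact Or.inr (by simp [h1, h2])

/-- `htB` is duplicate-free (filters of `boxLabels11` with pairwise contradictory predicates). [formal bookkeeping] -/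
theorem htB_nodup (c w : (Fin 3 × Fin 3) ⊕ Fin 3 → ℤ) : (htB c w).Nodup := by
  have hN : (htNear c w).Nodup := boxLabels11_nodup.filter _
  have h12 : (htCen c w ++ htNai c w).Nodup := nodup_filter_append hN _
  have hF1 : (htFar1 c w).Nodup := boxLabels11_nodup.filter _
  have hF2 : (htFar2 c w).Nodup := boxLabels11_nodup.filter _
  have hmemN : ∀ b ∈ htCen c w ++ htNai c w, decide ((fjQ c w b).lo < htA1) = true := by
    intro b hb
    rcases List.mem_append.1 hb with hb | hb
    · have := (List.mem_filter.1 (List.mem_filter.1 hb).1).2; simp only [Bool.and_eq_true] at this; exact this.2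
    · have := (List.mem_filter.1 (List.mem_filter.1 hb).1).2; simp only [Bool.and_eq_true] at this; exact this.2
  have h123 : ((htCen c w ++ htNai c w) ++ htFar1 c w).Nodup := by
    rw [List.nodup_append]
    refine ⟨h12, hF1, fun a ha b hb hab => ?_⟩
    subst hab
    have h1 := hmemN a ha
    have h2 := (List.mem_filter.1 hb).2
    simp only [Bool.and_eq_true, Bool.not_eq_true'] at h2
    rw [h1] at h2
    exact Bool.noConfusion h2.1.2
  rw [htB, List.nodup_append]
  refine ⟨h123, hF2, fun a ha b hb hab => ?_⟩
  subst hab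
  have h2 := (List.mem_filter.1 hb).2
  simp only [Bool.and_eq_true, Bool.not_eq_true'] at h2
  rcases List.mem_append.1 ha with ha | ha
  · have h1 := hmemN a ha
    rw [h1] at h2
    exact Bool.noConfusion h2.1.2
  · have h1 := (List.mem_filter.1 ha).2
    simp only [Bool.and_eq_true, Bool.not_eq_true'] at h1
    rw [h1.2] at h2
    exact Bool.noConfusion h2.2

/-- Labels of `htB` are box labels. [formal bookkeeping] -/
theorem mem_boxLabels11_of_mem_htB {c w : (Fin 3 × Fin 3) ⊕ Fin 3 → ℤ} {b : Fin 3 → ℤ} (h : b ∈ htB c w) : b ∈ boxLabels11 := by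
  simp only [htB, List.mem_append, htCen, htNai, htNear, htFar1, htFar2, List.mem_filter] at h
  rcases h with ((⟨⟨h, _⟩, _⟩ | ⟨⟨h, _⟩, _⟩) | ⟨h, _⟩) | ⟨h, _⟩ <;> exact h

/-- Labels of `htB` are certainly inside. [formal bookkeeping] -/
theorem htIn_of_mem_htB {c w : (Fin 3 × Fin 3) ⊕ Fin 3 → ℤ} {b : Fin 3 → ℤ} (h : b ∈ htB c w) : htIn c w b = true := by
  simp only [htB, List.mem_append, htCen, htNai, htNear, htFar1, htFar2, List.mem_filter, Bool.and_eq_true] at h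
  rcases h with ((⟨⟨_, h, _⟩, _⟩ | ⟨⟨_, h, _⟩, _⟩) | ⟨_, ⟨h, _⟩, _⟩) | ⟨_, ⟨h, _⟩, _⟩ <;> exact h

/-- `refW` keeps the entry half-widths. [formal bookkeeping] -/
theorem refW_inl (w : (Fin 3 × Fin 3) ⊕ Fin 3 → ℤ) (ab : Fin 3 × Fin 3) : refW w (Sum.inl ab) = w (Sum.inl ab) := rfl

/-- `refW` zeroes the shuffle half-widths. [formal bookkeeping] -/
theorem refW_inr (w : (Fin 3 × Fin 3) ⊕ Fin 3 → ℤ) (i : Fin 3) : refW w (Sum.inr i) = 0 := rfl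

/-! ## §2. The certificate payload, the slab constant, the PSD confinement certificate and the confined widths -/

/-- The certificate payload of the slab leaf (computed by the driver, CHECKED by the kernel): symmetric integer matrix shift `D` of the curvature kit,
near floor `lam₁` (with the shift), far chunk floors `lam₂`, `lam₃`, slope constant `Gs` on the reference box, and per-coordinate AM–GM parameters `γS`
and confinement radii `rS` (all scaled by `SC`). -/
structure HTCert where
  /-- matrix shift -/
  D : Fin 3 → Fin 3 → ℤ
  /-- near floor -/
  lam₁ : ℤ
  /-- far chunk floor 1 -/
  lam₂ : ℤ
  /-- far chunk floor 2 -/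
  lam₃ : ℤ
  /-- slope constant -/
  Gs : ℤ
  /-- AM–GM parameters -/
  γS : Fin 3 → ℤ
  /-- confinement radii in the displacement frame -/
  rS : Fin 3 → ℤ

/-- The total isotropic floor `lam₁ + lam₂ + lam₃`. -/
def HTCert.lamT (p : HTCert) : ℤ := p.lam₁ + p.lam₂ + p.lam₃

/-- The scaled slab constant `t·SC ≥ (S₇♯(7) + Gs/SC + |R|·6⁻⁷)·SC` (`S₇♯(7) = 8892/7⁷`, `6⁷ = 279936`). -/
def htT (p : HTCert) (c w : (Fin 3 × Fin 3) ⊕ Fin 3 → ℤ) : ℤ :=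
  cdiv (8892 * (SC : ℤ)) 823543 + p.Gs + ((htR c w).length : ℤ) * cdiv (SC : ℤ) 279936

/-- The integer matrix of the coordinate-`k` confinement certificate: `N = 2γr(λ_T·1 + D) − t·SC²·1 − tγ²·e_k e_kᵀ` (all scaled). -/
def htN (p : HTCert) (t : ℤ) (k i j : Fin 3) : ℤ :=
  2 * p.γS k * p.rS k * ((if i = j then p.lamT else 0) + p.D i j) - (if i = j then t * (SC : ℤ) * SC else 0) -
    (if i = k ∧ j = k then t * p.γS k ^ 2 else 0)

/-- The PSD certificate of the coordinate-`k` confinement (sign-vertex / LDLᵀ test on the point matrix `N/SC`). -/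
def htConf (p : HTCert) (c w : (Fin 3 × Fin 3) ⊕ Fin 3 → ℤ) (k : Fin 3) : Bool :=
  hertzTest (fun i j => FI.ofScaled (htN p (htT p c w) k i j)) (fun _ _ => 0) 0

/-- Scaled bound of the row deviation `Σ_j |U_kj − δ_kj|·SC` on the entry box. -/
def htκ (c w : (Fin 3 × Fin 3) ⊕ Fin 3 → ℤ) (k : Fin 3) : ℤ :=
  ∑ j : Fin 3, (|c (Sum.inl (k, j)) - (if k = j then (SC : ℤ) else 0)| + w (Sum.inl (k, j)))

/-- Scaled bound of `√(Σ_j r_j²)`. -/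
def htρ (p : HTCert) : ℤ := (FI.sqrt ⟨0, cdiv (∑ j : Fin 3, p.rS j ^ 2) SC⟩).hi

/-- The CONFINED box: same entries, ξ-half-widths `r_k + κ_k·(4/3)·ρ` (scaled, rounded up). -/
def htW (p : HTCert) (c w : (Fin 3 × Fin 3) ⊕ Fin 3 → ℤ) : (Fin 3 × Fin 3) ⊕ Fin 3 → ℤ :=
  Sum.elim (fun ab => w (Sum.inl ab)) fun k => p.rS k + cdiv (htκ c w k * 4 * htρ p) (3 * SC)

/-- All scalar side conditions and the three PSD certificates. -/
def htCertOK (p : HTCert) (c w : (Fin 3 × Fin 3) ⊕ Fin 3 → ℤ) : Bool :=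
  decide (0 < htT p c w) && (decide (0 < p.γS 0) && decide (0 < p.γS 1) && decide (0 < p.γS 2)) &&
    (decide (0 ≤ p.rS 0) && decide (0 ≤ p.rS 1) && decide (0 ≤ p.rS 2)) && (htConf p c w 0 && htConf p c w 1 && htConf p c w 2)

/-- Unpacking `htCertOK`. [formal bookkeeping] -/
theorem htCertOK_spec {p : HTCert} {c w : (Fin 3 × Fin 3) ⊕ Fin 3 → ℤ} (h : htCertOK p c w = true) :
    0 < htT p c w ∧ (∀ k : Fin 3, 0 < p.γS k) ∧ (∀ k : Fin 3, 0 ≤ p.rS k) ∧ (∀ k : Fin 3, htConf p c w k = true) := by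
  simp only [htCertOK, Bool.and_eq_true, decide_eq_true_eq] at h
  obtain ⟨⟨⟨ht, ⟨hγ0, hγ1⟩, hγ2⟩, ⟨hr0, hr1⟩, hr2⟩, ⟨hc0, hc1⟩, hc2⟩ := h
  refine ⟨ht, fun k => ?_, fun k => ?_, fun k => ?_⟩ <;> fin_cases k <;> assumption

/-- The quadratic form of the certificate matrix, expanded. [arithmetic] -/
theorem htN_form (p : HTCert) (t : ℤ) (k : Fin 3) (x : E3) :
    ∑ i : Fin 3, ∑ j : Fin 3, (htN p t k i j : ℝ) * (x i * x j) =
      2 * (p.γS k : ℝ) * (p.rS k) * ((p.lamT : ℝ) * ∑ i : Fin 3, x i ^ 2 + ∑ i : Fin 3, ∑ j : Fin 3, (p.D i j : ℝ) * (x i * x j)) -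
        (t : ℝ) * SC * SC * ∑ i : Fin 3, x i ^ 2 - (t : ℝ) * (p.γS k) ^ 2 * (x k) ^ 2 := by
  have e01 := eq_false (show (0 : Fin 3) ≠ 1 by decide)
  have e02 := eq_false (show (0 : Fin 3) ≠ 2 by decide)
  have e10 := eq_false (show (1 : Fin 3) ≠ 0 by decide)
  have e12 := eq_false (show (1 : Fin 3) ≠ 2 by decide)
  have e20 := eq_false (show (2 : Fin 3) ≠ 0 by decide)
  have e21 := eq_false (show (2 : Fin 3) ≠ 1 by decide)
  have f0 : (⟨0, by decide⟩ : Fin 3) = 0 := rfl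
  have f1 : (⟨1, by decide⟩ : Fin 3) = 1 := rfl
  have f2 : (⟨2, by decide⟩ : Fin 3) = 2 := rfl
  fin_cases k <;>
  · simp only [f0, f1, f2]
    simp only [htN, Fin.sum_univ_three, Fin.isValue, e01, e02, e10, e12, e20, e21, if_true, if_false, and_self, true_and, false_and,
      Int.cast_sub, Int.cast_mul, Int.cast_add, Int.cast_ofNat, Int.cast_zero, Int.cast_natCast, sub_zero]
    push_cast
    ring

/-- ★ **SOUNDNESS OF THE CONFINEMENT CERTIFICATE**: `htConf p c w k` gives the hypothesis of `…HomSlabConfine.abs_apply_le_of_qcert` for the Q-form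
`Q(x) = (λ_T/SC)‖x‖² + Σ_ij (D_ij/SC) x_i x_j`, `t = htT/SC`, `γ = γS_k/SC`, `r = rS_k/SC`. [folklore] -/
theorem htConf_sound {p : HTCert} {c w : (Fin 3 × Fin 3) ⊕ Fin 3 → ℤ} {k : Fin 3} (h : htConf p c w k = true) (x : E3) :
    (htT p c w : ℝ) / SC * ‖x‖ ^ 2 + (htT p c w : ℝ) / SC * ((p.γS k : ℝ) / SC) ^ 2 * (x k) ^ 2 ≤
      2 * ((p.γS k : ℝ) / SC) * ((p.rS k : ℝ) / SC) *
        ((p.lamT : ℝ) / SC * ‖x‖ ^ 2 + ∑ i : Fin 3, ∑ j : Fin 3, (p.D i j : ℝ) / SC * (x i * x j)) := by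
  have hS : (0 : ℝ) < SC := by norm_num [SC]
  have key := quadForm_ge_of_hertzTest h (M := fun i j => (htN p (htT p c w) k i j : ℝ) / SC) (P := fun _ _ => 0)
    (fun i j => FI.mem_ofScaled _) (fun i j => by simp) (fun i => x i)
  simp only [Int.cast_zero, zero_div, zero_mul, add_zero] at key
  -- `0 ≤ Σ_ij N_ij x_i x_j`
  have key0 : 0 ≤ ∑ i : Fin 3, ∑ j : Fin 3, (htN p (htT p c w) k i j : ℝ) * (x i * x j) := by
    have e : ∑ i : Fin 3, ∑ j : Fin 3, (htN p (htT p c w) k i j : ℝ) / SC * (x i * x j) =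
        (∑ i : Fin 3, ∑ j : Fin 3, (htN p (htT p c w) k i j : ℝ) * (x i * x j)) / SC := by
      rw [Finset.sum_div]
      refine Finset.sum_congr rfl fun i _ => ?_
      rw [Finset.sum_div]
      exact Finset.sum_congr rfl fun j _ => by ring
    rw [e] at key
    exact (div_nonneg_iff.1 key).elim (fun h => h.1) fun h => by linarith [h.2]
  rw [htN_form] at key0
  have hA : ‖x‖ ^ 2 = ∑ i : Fin 3, x i ^ 2 := by
    rw [EuclideanSpace.norm_sq_eq]
    exact Finset.sum_congr rfl fun i _ => by rw [Real.norm_eq_abs, sq_abs]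
  have hB : ∑ i : Fin 3, ∑ j : Fin 3, (p.D i j : ℝ) / SC * (x i * x j) = (∑ i : Fin 3, ∑ j : Fin 3, (p.D i j : ℝ) * (x i * x j)) / SC := by
    rw [Finset.sum_div]
    refine Finset.sum_congr rfl fun i _ => ?_
    rw [Finset.sum_div]
    exact Finset.sum_congr rfl fun j _ => by ring
  rw [hA, hB]
  set A : ℝ := ∑ i : Fin 3, x i ^ 2 with hAdef
  set B : ℝ := ∑ i : Fin 3, ∑ j : Fin 3, (p.D i j : ℝ) * (x i * x j) with hBdef
  rw [← sub_nonneg]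
  have e : 2 * ((p.γS k : ℝ) / SC) * ((p.rS k : ℝ) / SC) * ((p.lamT : ℝ) / SC * A + B / SC) -
      ((htT p c w : ℝ) / SC * A + (htT p c w : ℝ) / SC * ((p.γS k : ℝ) / SC) ^ 2 * (x k) ^ 2) =
      (2 * (p.γS k : ℝ) * (p.rS k) * ((p.lamT : ℝ) * A + B) - (htT p c w : ℝ) * SC * SC * A - (htT p c w : ℝ) * (p.γS k) ^ 2 * (x k) ^ 2) / SC ^ 3 := by
    field_simp
    ring
  rw [e]
  positivity

end Summit.AtomisticToContinuum.Crystallization.Theorems.FrustratedLawDichotomyStrainedPatchHomEntryLeafHT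

end
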